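import Summits.Ventures.QEC.Census.BB.BB108Rank
import Summits.Ventures.QEC.Census.CertCheck
import Summits.Ventures.QEC.Theses.BB108DistanceCertificate
import HarnessLib

/-!
# Route BB108DistanceCertificate, item WeightTenZLogical108 (stmt-Ventures-19829): `BB.bb108` (`QC(x³+y+y², y³+x+x²)`
# on `ℤ₉ × ℤ₆`, the `[[108,8,10]]` CLAIM) has a `Z`-logical of weight exactly `10`

The kernel-A certificate `cert/BB108.certA.json` (matrix_sha256 `9f2308102e008364…`, qec-search-1) lists the upper
witness `upper.witness_Z` — a weight-10 `Z`-type operator with zero `H^X`-syndrome — and its NON-MEMBERSHIP witness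
(`H^Z u = 0`, odd overlap ⇒ `w ∉ rowspace H^Z`, type-02's `not_mem_rowSpace_of_witness`). The two words are checked
against qec-type-02's row words `Census.bb108HX` / `bb108HZ` (`Census/BB/BB108Rank.lean`; the same numerals as the
certificate's `HX`/`HZ`, verified bit for bit at transcription) by type-10's `upperOK` (`decide +kernel`),
`upper_sound` gives the flat witness, and type-02's index identity `rowMatrix_bb108HX : rowMatrix 108 bb108HX =
BB.bb108.HXFlat` with type-05's `BB.Code.zWitness_of_flat` transports it to the typed code. Tier KERNEL, axioms
standard. This certifies `d_Z(BB.bb108) ≤ 10`; the lower bound is item NoZLogicalBelowTen108.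
-/

namespace Summit.Ventures.QEC.Census.BB108

open Matrix Literature.InformationTheory.QuantumCodes

/-- The certificate's weight-10 `Z`-witness (support of `upper.witness_Z`, bit `j` = qubit `j`). DATA. -/
def witnessZ : ℕ := 40566676136251735694218985800192

/-- Its non-membership witness (`upper.witness_Z.nonmember_witness`): in `ker H^Z`, odd overlap with `witnessZ`. DATA. -/
def nonmemberZ : ℕ := 6921319353342801602

/-- The `Z`-side upper check passes (kernel `decide`) on type-02's row words. -/
theorem upperZ_ok108 : upperOK 108 bb108HX bb108HZ 10 witnessZ nonmemberZ = true := by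
  decide +kernel

/-- Commutation of the row words, inherited from the typed code through type-02's index identities. -/
theorem comm_flat108 : rowMatrix 108 bb108HX * (rowMatrix 108 bb108HZ)ᵀ = 0 := by
  rw [rowMatrix_bb108HX, rowMatrix_bb108HZ]
  exact BB.bb108.HXFlat_mul_HZFlat_transpose

/-- **Item WeightTenZLogical108, PROVED**: some `Z`-type logical operator of `BB.bb108` has Hamming weight exactly
`10` — the certificate's upper witness, checked in the kernel and transported to the typed code. -/
theorem weightTenZLogical108_proof : Summit.Ventures.QEC.Theses.BB108DistanceCertificate.WeightTenZLogical108 := by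
  obtain ⟨hv, hv', hwt⟩ := upper_sound upperZ_ok108
  exact BB.bb108.zWitness_of_flat (D := CSSCode.ofMatrices (rowMatrix 108 bb108HX) (rowMatrix 108 bb108HZ) comm_flat108)
    rowMatrix_bb108HX rowMatrix_bb108HZ ⟨ofBits 108 witnessZ, hv, hv', hwt⟩

end Summit.Ventures.QEC.Census.BB108
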